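import Literature.NumberTheory.Sieve.DrappeauDispersionR1ppDecomp
import HarnessLib

/-!
# Drappeau 2017, §5.5: edge cases of `ℛ₁''` and the side conditions of the decomposition

Topic `Literature/NumberTheory/Sieve`, part of the formalisation of §5 of S. Drappeau, Proc. London
Math. Soc. (3) 114 (2017) 684–732 = arXiv:1504.05549, p. 20–21.  Small facts used when the
decomposition `norm_R1pp_le_sum_blocks` is combined with Theorem 2.1: `ℛ₁''(ξ,λ₁,λ₂)` vanishes for
`ξ ≤ 0` (the profile `α` is supported in `(1/2, 5/2)`) and for classes `λ_j` not reduced or not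
coprime to `m = |a₂|n₀`; the frequency cut-off `H` is below `W = q₀q₁q₂` on the support of
`γ ⊗ γ` as soon as `H < (S−Y)²/q₀`; `1 ∉ B` when `2n₀ ≤ N`; and the size of the rough variable.
Everything proved (no definition, no named fact).

## References

* S. Drappeau, Proc. London Math. Soc. (3) 114 (2017) 684–732, arXiv:1504.05549, §5.5 p. 20–21.
  [cite: Drappeau2017, §5.5]
-/

noncomputable section

open Finset Real Complex
open scoped ArithmeticFunction.Moebius FourierTransform

namespace Literature.NumberTheory.Sieve

namespace Drappeau2017

open KloostermanQuintilinear

section Edge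

variable {S Y N M : ℝ} {a₁ a₂ : ℤ} {q₀ n₀ : ℕ} {l₁ l₂ : ℕ} {β : ℕ → ℂ} {ξ : ℝ} {H : ℕ}

/-- **`ℛ₁'' = 0` for `ξ ≤ 0`** (`M > 0`): every term carries `α(Wξ/M)` with `Wξ/M ≤ 0 < 1/2`.
[cite: Drappeau2017, §5.2, §5.5] -/
theorem R1pp_eq_zero_of_xi_nonpos (hM : 0 < M) (hξ : ξ ≤ 0) :
    ∑ q₁ ∈ ((((((BFI.mRange S Y).filter (fun q : ℕ => 0 < q)).filter (fun q : ℕ => IsCoprime (q : ℤ) (a₁ * a₂))).filter (fun q : ℕ => q₀ ∣ q)).image (fun q : ℕ => q / q₀)).filter (fun q : ℕ => q % (a₂.natAbs * n₀) = l₁)),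
        ∑ q₂ ∈ ((((((BFI.mRange S Y).filter (fun q : ℕ => 0 < q)).filter (fun q : ℕ => IsCoprime (q : ℤ) (a₁ * a₂))).filter (fun q : ℕ => q₀ ∣ q)).image (fun q : ℕ => q / q₀)).filter (fun q : ℕ => q % (a₂.natAbs * n₀) = l₂)),
          ((BFI.bump S Y ((q₀ * q₁ : ℕ) : ℝ) : ℝ) : ℂ) * ((BFI.bump S Y ((q₀ * q₂ : ℕ) : ℝ) : ℝ) : ℂ) *
        ∑ n₁ ∈ ((((BFI.dyadic N).filter (fun n : ℕ => IsCoprime (n : ℤ) a₂)).filter (fun n : ℕ => n₀ ∣ n)).image (fun n : ℕ => n / n₀)), ∑ n₂ ∈ ((((BFI.dyadic N).filter (fun n : ℕ => IsCoprime (n : ℤ) a₂)).filter (fun n : ℕ => n₀ ∣ n)).image (fun n : ℕ => n / n₀)),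
          (if (Nat.Coprime q₁ q₂ ∧ Nat.Coprime n₁ n₂) then (1 : ℂ) else 0) *
            (β (n₀ * n₁) * starRingEnd ℂ (β (n₀ * n₂))) *
          (if ((n₀ * n₁).Coprime (q₀ * q₁) ∧ (n₀ * n₂).Coprime (q₀ * q₂) ∧ n₁ ≡ n₂ [MOD q₀]) then
              ∑ h ∈ Finset.Icc (-(H : ℤ)) H,
                (if ((Nat.lcm (q₀ * q₁) (q₀ * q₂) : ℕ) : ℤ) ∣ h then 0 else
                  (𝐞 (-(ξ * h)) : ℂ) * BFI.bumpC 1 (1 / 2) ((Nat.lcm (q₀ * q₁) (q₀ * q₂) : ℕ) * ξ / M) *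
                    ((𝐞 ((h : ℝ) * a₁ * ((((n₁ : ℤ) - n₂) / q₀ : ℤ)) *
                    ((((((q₁ : ℤ) * a₂ * n₀ * n₂ : ℤ) : ZMod (n₁ * q₂))⁻¹).val : ℕ) : ℝ) /
                      ((n₁ : ℝ) * q₂)) : ℂ) *
                      (𝐞 (-((h : ℝ) * a₁ *
                    ((((((q₀ : ℤ) * l₁ * l₂ * n₁ : ℤ) : ZMod (a₂.natAbs * n₀))⁻¹).val : ℕ) : ℝ) /
                      ((a₂ : ℝ) * n₀))) : ℂ)))
            else 0) = 0 := by
  refine Finset.sum_eq_zero fun q₁ _ => Finset.sum_eq_zero fun q₂ _ => ?_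
  rw [Finset.sum_eq_zero fun n₁ _ => Finset.sum_eq_zero fun n₂ _ => ?_, mul_zero]
  have hα : BFI.bumpC 1 (1 / 2) ((Nat.lcm (q₀ * q₁) (q₀ * q₂) : ℕ) * ξ / M) = 0 := by
    refine BFI.bumpC_eq_zero (by norm_num) zero_le_one (Or.inl ?_)
    have : ((Nat.lcm (q₀ * q₁) (q₀ * q₂) : ℕ) : ℝ) * ξ / M ≤ 0 :=
      div_nonpos_of_nonpos_of_nonneg (mul_nonpos_of_nonneg_of_nonpos (by positivity) hξ) hM.le
    linarith
  split_ifs with h1 h2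
  · rw [Finset.sum_eq_zero fun h _ => ?_, mul_zero]
    split_ifs
    · rfl
    · rw [hα]; simp
  · simp
  · simp
  · simp

/-- `q % (b n) = l ⟹ (Coprime q n ↔ Coprime l n)`. [folklore] -/
theorem coprime_iff_of_mod_mul_left {q b n l : ℕ} (h : q % (b * n) = l) :
    Nat.Coprime q n ↔ Nat.Coprime l n := by
  have e1 : q % n = l % n := by rw [← Nat.mod_mul_left_mod q b n, h]
  unfold Nat.Coprime
  rw [Nat.gcd_comm q n, Nat.gcd_comm l n, Nat.gcd_rec n q, Nat.gcd_rec n l, e1]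

/-- `q % (n b) = l ⟹ (Coprime q n ↔ Coprime l n)`. [folklore] -/
theorem coprime_iff_of_mod_mul_right {q b n l : ℕ} (h : q % (n * b) = l) :
    Nat.Coprime q n ↔ Nat.Coprime l n :=
  coprime_iff_of_mod_mul_left (b := b) (by rwa [mul_comm])

/-- **`ℛ₁'' = 0` unless `(λ₁, n₀) = 1`.** [cite: Drappeau2017, §5.5] -/
theorem R1pp_eq_zero_of_fst_class_n (hl : ¬ Nat.Coprime l₁ n₀) :
    ∑ q₁ ∈ ((((((BFI.mRange S Y).filter (fun q : ℕ => 0 < q)).filter (fun q : ℕ => IsCoprime (q : ℤ) (a₁ * a₂))).filter (fun q : ℕ => q₀ ∣ q)).image (fun q : ℕ => q / q₀)).filter (fun q : ℕ => q % (a₂.natAbs * n₀) = l₁)),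
        ∑ q₂ ∈ ((((((BFI.mRange S Y).filter (fun q : ℕ => 0 < q)).filter (fun q : ℕ => IsCoprime (q : ℤ) (a₁ * a₂))).filter (fun q : ℕ => q₀ ∣ q)).image (fun q : ℕ => q / q₀)).filter (fun q : ℕ => q % (a₂.natAbs * n₀) = l₂)),
          ((BFI.bump S Y ((q₀ * q₁ : ℕ) : ℝ) : ℝ) : ℂ) * ((BFI.bump S Y ((q₀ * q₂ : ℕ) : ℝ) : ℝ) : ℂ) *
        ∑ n₁ ∈ ((((BFI.dyadic N).filter (fun n : ℕ => IsCoprime (n : ℤ) a₂)).filter (fun n : ℕ => n₀ ∣ n)).image (fun n : ℕ => n / n₀)), ∑ n₂ ∈ ((((BFI.dyadic N).filter (fun n : ℕ => IsCoprime (n : ℤ) a₂)).filter (fun n : ℕ => n₀ ∣ n)).image (fun n : ℕ => n / n₀)),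
          (if (Nat.Coprime q₁ q₂ ∧ Nat.Coprime n₁ n₂) then (1 : ℂ) else 0) *
            (β (n₀ * n₁) * starRingEnd ℂ (β (n₀ * n₂))) *
          (if ((n₀ * n₁).Coprime (q₀ * q₁) ∧ (n₀ * n₂).Coprime (q₀ * q₂) ∧ n₁ ≡ n₂ [MOD q₀]) then
              ∑ h ∈ Finset.Icc (-(H : ℤ)) H,
                (if ((Nat.lcm (q₀ * q₁) (q₀ * q₂) : ℕ) : ℤ) ∣ h then 0 else
                  (𝐞 (-(ξ * h)) : ℂ) * BFI.bumpC 1 (1 / 2) ((Nat.lcm (q₀ * q₁) (q₀ * q₂) : ℕ) * ξ / M) *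
                    ((𝐞 ((h : ℝ) * a₁ * ((((n₁ : ℤ) - n₂) / q₀ : ℤ)) *
                    ((((((q₁ : ℤ) * a₂ * n₀ * n₂ : ℤ) : ZMod (n₁ * q₂))⁻¹).val : ℕ) : ℝ) /
                      ((n₁ : ℝ) * q₂)) : ℂ) *
                      (𝐞 (-((h : ℝ) * a₁ *
                    ((((((q₀ : ℤ) * l₁ * l₂ * n₁ : ℤ) : ZMod (a₂.natAbs * n₀))⁻¹).val : ℕ) : ℝ) /
                      ((a₂ : ℝ) * n₀))) : ℂ)))
            else 0) = 0 := by
  refine Finset.sum_eq_zero fun q₁ hq₁ => Finset.sum_eq_zero fun q₂ _ => ?_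
  rw [Finset.mem_filter] at hq₁
  have hq₁n : ¬ Nat.Coprime q₁ n₀ := fun hc => hl ((coprime_iff_of_mod_mul_left hq₁.2).1 hc)
  rw [Finset.sum_eq_zero fun n₁ _ => Finset.sum_eq_zero fun n₂ _ => ?_, mul_zero]
  have hnc : ¬ ((n₀ * n₁).Coprime (q₀ * q₁) ∧ (n₀ * n₂).Coprime (q₀ * q₂) ∧ n₁ ≡ n₂ [MOD q₀]) := by
    rintro ⟨h1, -, -⟩
    exact hq₁n (h1.coprime_mul_right.coprime_mul_left_right).symm
  rw [if_neg hnc, mul_zero]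

/-- **`ℛ₁'' = 0` unless `(λ₂, n₀) = 1`.** [cite: Drappeau2017, §5.5] -/
theorem R1pp_eq_zero_of_snd_class_n (hl : ¬ Nat.Coprime l₂ n₀) :
    ∑ q₁ ∈ ((((((BFI.mRange S Y).filter (fun q : ℕ => 0 < q)).filter (fun q : ℕ => IsCoprime (q : ℤ) (a₁ * a₂))).filter (fun q : ℕ => q₀ ∣ q)).image (fun q : ℕ => q / q₀)).filter (fun q : ℕ => q % (a₂.natAbs * n₀) = l₁)),
        ∑ q₂ ∈ ((((((BFI.mRange S Y).filter (fun q : ℕ => 0 < q)).filter (fun q : ℕ => IsCoprime (q : ℤ) (a₁ * a₂))).filter (fun q : ℕ => q₀ ∣ q)).image (fun q : ℕ => q / q₀)).filter (fun q : ℕ => q % (a₂.natAbs * n₀) = l₂)),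
          ((BFI.bump S Y ((q₀ * q₁ : ℕ) : ℝ) : ℝ) : ℂ) * ((BFI.bump S Y ((q₀ * q₂ : ℕ) : ℝ) : ℝ) : ℂ) *
        ∑ n₁ ∈ ((((BFI.dyadic N).filter (fun n : ℕ => IsCoprime (n : ℤ) a₂)).filter (fun n : ℕ => n₀ ∣ n)).image (fun n : ℕ => n / n₀)), ∑ n₂ ∈ ((((BFI.dyadic N).filter (fun n : ℕ => IsCoprime (n : ℤ) a₂)).filter (fun n : ℕ => n₀ ∣ n)).image (fun n : ℕ => n / n₀)),
          (if (Nat.Coprime q₁ q₂ ∧ Nat.Coprime n₁ n₂) then (1 : ℂ) else 0) *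
            (β (n₀ * n₁) * starRingEnd ℂ (β (n₀ * n₂))) *
          (if ((n₀ * n₁).Coprime (q₀ * q₁) ∧ (n₀ * n₂).Coprime (q₀ * q₂) ∧ n₁ ≡ n₂ [MOD q₀]) then
              ∑ h ∈ Finset.Icc (-(H : ℤ)) H,
                (if ((Nat.lcm (q₀ * q₁) (q₀ * q₂) : ℕ) : ℤ) ∣ h then 0 else
                  (𝐞 (-(ξ * h)) : ℂ) * BFI.bumpC 1 (1 / 2) ((Nat.lcm (q₀ * q₁) (q₀ * q₂) : ℕ) * ξ / M) *
                    ((𝐞 ((h : ℝ) * a₁ * ((((n₁ : ℤ) - n₂) / q₀ : ℤ)) *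
                    ((((((q₁ : ℤ) * a₂ * n₀ * n₂ : ℤ) : ZMod (n₁ * q₂))⁻¹).val : ℕ) : ℝ) /
                      ((n₁ : ℝ) * q₂)) : ℂ) *
                      (𝐞 (-((h : ℝ) * a₁ *
                    ((((((q₀ : ℤ) * l₁ * l₂ * n₁ : ℤ) : ZMod (a₂.natAbs * n₀))⁻¹).val : ℕ) : ℝ) /
                      ((a₂ : ℝ) * n₀))) : ℂ)))
            else 0) = 0 := by
  refine Finset.sum_eq_zero fun q₁ _ => Finset.sum_eq_zero fun q₂ hq₂ => ?_
  rw [Finset.mem_filter] at hq₂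
  have hq₂n : ¬ Nat.Coprime q₂ n₀ := fun hc => hl ((coprime_iff_of_mod_mul_left hq₂.2).1 hc)
  rw [Finset.sum_eq_zero fun n₁ _ => Finset.sum_eq_zero fun n₂ _ => ?_, mul_zero]
  have hnc : ¬ ((n₀ * n₁).Coprime (q₀ * q₁) ∧ (n₀ * n₂).Coprime (q₀ * q₂) ∧ n₁ ≡ n₂ [MOD q₀]) := by
    rintro ⟨-, h1, -⟩
    exact hq₂n (h1.coprime_mul_right.coprime_mul_left_right).symm
  rw [if_neg hnc, mul_zero]

/-- Elements of the moduli set of `ℛ₁''` are coprime to `|a₂|`. [folklore] -/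
theorem coprime_abs_of_mem_moduli {q : ℕ}
    (hq : q ∈ (((((BFI.mRange S Y).filter (fun q : ℕ => 0 < q)).filter (fun q : ℕ => IsCoprime (q : ℤ) (a₁ * a₂))).filter (fun q : ℕ => q₀ ∣ q)).image (fun q : ℕ => q / q₀))) : Nat.Coprime q a₂.natAbs := by
  simp only [Finset.mem_image, Finset.mem_filter] at hq
  obtain ⟨q', ⟨⟨_, hcop⟩, hdvd⟩, rfl⟩ := hq
  rw [IsCoprime.mul_right_iff] at hcop
  rw [← isCoprime_natCast_left_iff]
  have e : (q' : ℤ) = (q₀ : ℤ) * ((q' / q₀ : ℕ) : ℤ) := by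
    rw [← Nat.cast_mul, Nat.mul_div_cancel' hdvd]
  have h2 := hcop.2
  rw [e] at h2
  exact h2.of_mul_left_right

/-- **`ℛ₁'' = 0` unless `(λ₁, |a₂|) = 1`** (the class is then empty). [cite: Drappeau2017, §5.5] -/
theorem R1pp_eq_zero_of_fst_class_a (hl : ¬ Nat.Coprime l₁ a₂.natAbs) :
    ∑ q₁ ∈ ((((((BFI.mRange S Y).filter (fun q : ℕ => 0 < q)).filter (fun q : ℕ => IsCoprime (q : ℤ) (a₁ * a₂))).filter (fun q : ℕ => q₀ ∣ q)).image (fun q : ℕ => q / q₀)).filter (fun q : ℕ => q % (a₂.natAbs * n₀) = l₁)),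
        ∑ q₂ ∈ ((((((BFI.mRange S Y).filter (fun q : ℕ => 0 < q)).filter (fun q : ℕ => IsCoprime (q : ℤ) (a₁ * a₂))).filter (fun q : ℕ => q₀ ∣ q)).image (fun q : ℕ => q / q₀)).filter (fun q : ℕ => q % (a₂.natAbs * n₀) = l₂)),
          ((BFI.bump S Y ((q₀ * q₁ : ℕ) : ℝ) : ℝ) : ℂ) * ((BFI.bump S Y ((q₀ * q₂ : ℕ) : ℝ) : ℝ) : ℂ) *
        ∑ n₁ ∈ ((((BFI.dyadic N).filter (fun n : ℕ => IsCoprime (n : ℤ) a₂)).filter (fun n : ℕ => n₀ ∣ n)).image (fun n : ℕ => n / n₀)), ∑ n₂ ∈ ((((BFI.dyadic N).filter (fun n : ℕ => IsCoprime (n : ℤ) a₂)).filter (fun n : ℕ => n₀ ∣ n)).image (fun n : ℕ => n / n₀)),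
          (if (Nat.Coprime q₁ q₂ ∧ Nat.Coprime n₁ n₂) then (1 : ℂ) else 0) *
            (β (n₀ * n₁) * starRingEnd ℂ (β (n₀ * n₂))) *
          (if ((n₀ * n₁).Coprime (q₀ * q₁) ∧ (n₀ * n₂).Coprime (q₀ * q₂) ∧ n₁ ≡ n₂ [MOD q₀]) then
              ∑ h ∈ Finset.Icc (-(H : ℤ)) H,
                (if ((Nat.lcm (q₀ * q₁) (q₀ * q₂) : ℕ) : ℤ) ∣ h then 0 else
                  (𝐞 (-(ξ * h)) : ℂ) * BFI.bumpC 1 (1 / 2) ((Nat.lcm (q₀ * q₁) (q₀ * q₂) : ℕ) * ξ / M) *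
                    ((𝐞 ((h : ℝ) * a₁ * ((((n₁ : ℤ) - n₂) / q₀ : ℤ)) *
                    ((((((q₁ : ℤ) * a₂ * n₀ * n₂ : ℤ) : ZMod (n₁ * q₂))⁻¹).val : ℕ) : ℝ) /
                      ((n₁ : ℝ) * q₂)) : ℂ) *
                      (𝐞 (-((h : ℝ) * a₁ *
                    ((((((q₀ : ℤ) * l₁ * l₂ * n₁ : ℤ) : ZMod (a₂.natAbs * n₀))⁻¹).val : ℕ) : ℝ) /
                      ((a₂ : ℝ) * n₀))) : ℂ)))
            else 0) = 0 := by
  refine Finset.sum_eq_zero fun q₁ hq₁ => ?_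
  exfalso
  rw [Finset.mem_filter] at hq₁
  exact hl ((coprime_iff_of_mod_mul_right hq₁.2).1 (coprime_abs_of_mem_moduli hq₁.1))

/-- **`ℛ₁'' = 0` unless `(λ₂, |a₂|) = 1`.** [cite: Drappeau2017, §5.5] -/
theorem R1pp_eq_zero_of_snd_class_a (hl : ¬ Nat.Coprime l₂ a₂.natAbs) :
    ∑ q₁ ∈ ((((((BFI.mRange S Y).filter (fun q : ℕ => 0 < q)).filter (fun q : ℕ => IsCoprime (q : ℤ) (a₁ * a₂))).filter (fun q : ℕ => q₀ ∣ q)).image (fun q : ℕ => q / q₀)).filter (fun q : ℕ => q % (a₂.natAbs * n₀) = l₁)),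
        ∑ q₂ ∈ ((((((BFI.mRange S Y).filter (fun q : ℕ => 0 < q)).filter (fun q : ℕ => IsCoprime (q : ℤ) (a₁ * a₂))).filter (fun q : ℕ => q₀ ∣ q)).image (fun q : ℕ => q / q₀)).filter (fun q : ℕ => q % (a₂.natAbs * n₀) = l₂)),
          ((BFI.bump S Y ((q₀ * q₁ : ℕ) : ℝ) : ℝ) : ℂ) * ((BFI.bump S Y ((q₀ * q₂ : ℕ) : ℝ) : ℝ) : ℂ) *
        ∑ n₁ ∈ ((((BFI.dyadic N).filter (fun n : ℕ => IsCoprime (n : ℤ) a₂)).filter (fun n : ℕ => n₀ ∣ n)).image (fun n : ℕ => n / n₀)), ∑ n₂ ∈ ((((BFI.dyadic N).filter (fun n : ℕ => IsCoprime (n : ℤ) a₂)).filter (fun n : ℕ => n₀ ∣ n)).image (fun n : ℕ => n / n₀)),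
          (if (Nat.Coprime q₁ q₂ ∧ Nat.Coprime n₁ n₂) then (1 : ℂ) else 0) *
            (β (n₀ * n₁) * starRingEnd ℂ (β (n₀ * n₂))) *
          (if ((n₀ * n₁).Coprime (q₀ * q₁) ∧ (n₀ * n₂).Coprime (q₀ * q₂) ∧ n₁ ≡ n₂ [MOD q₀]) then
              ∑ h ∈ Finset.Icc (-(H : ℤ)) H,
                (if ((Nat.lcm (q₀ * q₁) (q₀ * q₂) : ℕ) : ℤ) ∣ h then 0 else
                  (𝐞 (-(ξ * h)) : ℂ) * BFI.bumpC 1 (1 / 2) ((Nat.lcm (q₀ * q₁) (q₀ * q₂) : ℕ) * ξ / M) *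
                    ((𝐞 ((h : ℝ) * a₁ * ((((n₁ : ℤ) - n₂) / q₀ : ℤ)) *
                    ((((((q₁ : ℤ) * a₂ * n₀ * n₂ : ℤ) : ZMod (n₁ * q₂))⁻¹).val : ℕ) : ℝ) /
                      ((n₁ : ℝ) * q₂)) : ℂ) *
                      (𝐞 (-((h : ℝ) * a₁ *
                    ((((((q₀ : ℤ) * l₁ * l₂ * n₁ : ℤ) : ZMod (a₂.natAbs * n₀))⁻¹).val : ℕ) : ℝ) /
                      ((a₂ : ℝ) * n₀))) : ℂ)))
            else 0) = 0 := by
  refine Finset.sum_eq_zero fun q₁ _ => Finset.sum_eq_zero fun q₂ hq₂ => ?_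
  exfalso
  rw [Finset.mem_filter] at hq₂
  exact hl ((coprime_iff_of_mod_mul_right hq₂.2).1 (coprime_abs_of_mem_moduli hq₂.1))

/-- **`ℛ₁'' = 0` unless `λ₁ < m`** (`m = |a₂|n₀ > 0`; the class is then empty). [folklore] -/
theorem R1pp_eq_zero_of_fst_class_ge (hm : 0 < a₂.natAbs * n₀) (hl : a₂.natAbs * n₀ ≤ l₁) :
    ∑ q₁ ∈ ((((((BFI.mRange S Y).filter (fun q : ℕ => 0 < q)).filter (fun q : ℕ => IsCoprime (q : ℤ) (a₁ * a₂))).filter (fun q : ℕ => q₀ ∣ q)).image (fun q : ℕ => q / q₀)).filter (fun q : ℕ => q % (a₂.natAbs * n₀) = l₁)),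
        ∑ q₂ ∈ ((((((BFI.mRange S Y).filter (fun q : ℕ => 0 < q)).filter (fun q : ℕ => IsCoprime (q : ℤ) (a₁ * a₂))).filter (fun q : ℕ => q₀ ∣ q)).image (fun q : ℕ => q / q₀)).filter (fun q : ℕ => q % (a₂.natAbs * n₀) = l₂)),
          ((BFI.bump S Y ((q₀ * q₁ : ℕ) : ℝ) : ℝ) : ℂ) * ((BFI.bump S Y ((q₀ * q₂ : ℕ) : ℝ) : ℝ) : ℂ) *
        ∑ n₁ ∈ ((((BFI.dyadic N).filter (fun n : ℕ => IsCoprime (n : ℤ) a₂)).filter (fun n : ℕ => n₀ ∣ n)).image (fun n : ℕ => n / n₀)), ∑ n₂ ∈ ((((BFI.dyadic N).filter (fun n : ℕ => IsCoprime (n : ℤ) a₂)).filter (fun n : ℕ => n₀ ∣ n)).image (fun n : ℕ => n / n₀)),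
          (if (Nat.Coprime q₁ q₂ ∧ Nat.Coprime n₁ n₂) then (1 : ℂ) else 0) *
            (β (n₀ * n₁) * starRingEnd ℂ (β (n₀ * n₂))) *
          (if ((n₀ * n₁).Coprime (q₀ * q₁) ∧ (n₀ * n₂).Coprime (q₀ * q₂) ∧ n₁ ≡ n₂ [MOD q₀]) then
              ∑ h ∈ Finset.Icc (-(H : ℤ)) H,
                (if ((Nat.lcm (q₀ * q₁) (q₀ * q₂) : ℕ) : ℤ) ∣ h then 0 else
                  (𝐞 (-(ξ * h)) : ℂ) * BFI.bumpC 1 (1 / 2) ((Nat.lcm (q₀ * q₁) (q₀ * q₂) : ℕ) * ξ / M) *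
                    ((𝐞 ((h : ℝ) * a₁ * ((((n₁ : ℤ) - n₂) / q₀ : ℤ)) *
                    ((((((q₁ : ℤ) * a₂ * n₀ * n₂ : ℤ) : ZMod (n₁ * q₂))⁻¹).val : ℕ) : ℝ) /
                      ((n₁ : ℝ) * q₂)) : ℂ) *
                      (𝐞 (-((h : ℝ) * a₁ *
                    ((((((q₀ : ℤ) * l₁ * l₂ * n₁ : ℤ) : ZMod (a₂.natAbs * n₀))⁻¹).val : ℕ) : ℝ) /
                      ((a₂ : ℝ) * n₀))) : ℂ)))
            else 0) = 0 := by
  refine Finset.sum_eq_zero fun q₁ hq₁ => ?_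
  exfalso
  rw [Finset.mem_filter] at hq₁
  have := Nat.mod_lt q₁ hm
  omega

/-- **`ℛ₁'' = 0` unless `λ₂ < m`.** [folklore] -/
theorem R1pp_eq_zero_of_snd_class_ge (hm : 0 < a₂.natAbs * n₀) (hl : a₂.natAbs * n₀ ≤ l₂) :
    ∑ q₁ ∈ ((((((BFI.mRange S Y).filter (fun q : ℕ => 0 < q)).filter (fun q : ℕ => IsCoprime (q : ℤ) (a₁ * a₂))).filter (fun q : ℕ => q₀ ∣ q)).image (fun q : ℕ => q / q₀)).filter (fun q : ℕ => q % (a₂.natAbs * n₀) = l₁)),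
        ∑ q₂ ∈ ((((((BFI.mRange S Y).filter (fun q : ℕ => 0 < q)).filter (fun q : ℕ => IsCoprime (q : ℤ) (a₁ * a₂))).filter (fun q : ℕ => q₀ ∣ q)).image (fun q : ℕ => q / q₀)).filter (fun q : ℕ => q % (a₂.natAbs * n₀) = l₂)),
          ((BFI.bump S Y ((q₀ * q₁ : ℕ) : ℝ) : ℝ) : ℂ) * ((BFI.bump S Y ((q₀ * q₂ : ℕ) : ℝ) : ℝ) : ℂ) *
        ∑ n₁ ∈ ((((BFI.dyadic N).filter (fun n : ℕ => IsCoprime (n : ℤ) a₂)).filter (fun n : ℕ => n₀ ∣ n)).image (fun n : ℕ => n / n₀)), ∑ n₂ ∈ ((((BFI.dyadic N).filter (fun n : ℕ => IsCoprime (n : ℤ) a₂)).filter (fun n : ℕ => n₀ ∣ n)).image (fun n : ℕ => n / n₀)),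
          (if (Nat.Coprime q₁ q₂ ∧ Nat.Coprime n₁ n₂) then (1 : ℂ) else 0) *
            (β (n₀ * n₁) * starRingEnd ℂ (β (n₀ * n₂))) *
          (if ((n₀ * n₁).Coprime (q₀ * q₁) ∧ (n₀ * n₂).Coprime (q₀ * q₂) ∧ n₁ ≡ n₂ [MOD q₀]) then
              ∑ h ∈ Finset.Icc (-(H : ℤ)) H,
                (if ((Nat.lcm (q₀ * q₁) (q₀ * q₂) : ℕ) : ℤ) ∣ h then 0 else
                  (𝐞 (-(ξ * h)) : ℂ) * BFI.bumpC 1 (1 / 2) ((Nat.lcm (q₀ * q₁) (q₀ * q₂) : ℕ) * ξ / M) *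
                    ((𝐞 ((h : ℝ) * a₁ * ((((n₁ : ℤ) - n₂) / q₀ : ℤ)) *
                    ((((((q₁ : ℤ) * a₂ * n₀ * n₂ : ℤ) : ZMod (n₁ * q₂))⁻¹).val : ℕ) : ℝ) /
                      ((n₁ : ℝ) * q₂)) : ℂ) *
                      (𝐞 (-((h : ℝ) * a₁ *
                    ((((((q₀ : ℤ) * l₁ * l₂ * n₁ : ℤ) : ZMod (a₂.natAbs * n₀))⁻¹).val : ℕ) : ℝ) /
                      ((a₂ : ℝ) * n₀))) : ℂ)))
            else 0) = 0 := by
  refine Finset.sum_eq_zero fun q₁ _ => Finset.sum_eq_zero fun q₂ hq₂ => ?_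
  exfalso
  rw [Finset.mem_filter] at hq₂
  have := Nat.mod_lt q₂ hm
  omega

/-- **Summary of the class edge cases**: `ℛ₁'' = 0` unless both classes are reduced residues
`< m` coprime to `m = |a₂|n₀`. [cite: Drappeau2017, §5.5] -/
theorem R1pp_eq_zero_of_bad_classes (hm : 0 < a₂.natAbs * n₀)
    (h : ¬ (l₁ < a₂.natAbs * n₀ ∧ l₂ < a₂.natAbs * n₀ ∧ Nat.Coprime l₁ (a₂.natAbs * n₀) ∧
      Nat.Coprime l₂ (a₂.natAbs * n₀))) :
    ∑ q₁ ∈ ((((((BFI.mRange S Y).filter (fun q : ℕ => 0 < q)).filter (fun q : ℕ => IsCoprime (q : ℤ) (a₁ * a₂))).filter (fun q : ℕ => q₀ ∣ q)).image (fun q : ℕ => q / q₀)).filter (fun q : ℕ => q % (a₂.natAbs * n₀) = l₁)),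
        ∑ q₂ ∈ ((((((BFI.mRange S Y).filter (fun q : ℕ => 0 < q)).filter (fun q : ℕ => IsCoprime (q : ℤ) (a₁ * a₂))).filter (fun q : ℕ => q₀ ∣ q)).image (fun q : ℕ => q / q₀)).filter (fun q : ℕ => q % (a₂.natAbs * n₀) = l₂)),
          ((BFI.bump S Y ((q₀ * q₁ : ℕ) : ℝ) : ℝ) : ℂ) * ((BFI.bump S Y ((q₀ * q₂ : ℕ) : ℝ) : ℝ) : ℂ) *
        ∑ n₁ ∈ ((((BFI.dyadic N).filter (fun n : ℕ => IsCoprime (n : ℤ) a₂)).filter (fun n : ℕ => n₀ ∣ n)).image (fun n : ℕ => n / n₀)), ∑ n₂ ∈ ((((BFI.dyadic N).filter (fun n : ℕ => IsCoprime (n : ℤ) a₂)).filter (fun n : ℕ => n₀ ∣ n)).image (fun n : ℕ => n / n₀)),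
          (if (Nat.Coprime q₁ q₂ ∧ Nat.Coprime n₁ n₂) then (1 : ℂ) else 0) *
            (β (n₀ * n₁) * starRingEnd ℂ (β (n₀ * n₂))) *
          (if ((n₀ * n₁).Coprime (q₀ * q₁) ∧ (n₀ * n₂).Coprime (q₀ * q₂) ∧ n₁ ≡ n₂ [MOD q₀]) then
              ∑ h ∈ Finset.Icc (-(H : ℤ)) H,
                (if ((Nat.lcm (q₀ * q₁) (q₀ * q₂) : ℕ) : ℤ) ∣ h then 0 else
                  (𝐞 (-(ξ * h)) : ℂ) * BFI.bumpC 1 (1 / 2) ((Nat.lcm (q₀ * q₁) (q₀ * q₂) : ℕ) * ξ / M) *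
                    ((𝐞 ((h : ℝ) * a₁ * ((((n₁ : ℤ) - n₂) / q₀ : ℤ)) *
                    ((((((q₁ : ℤ) * a₂ * n₀ * n₂ : ℤ) : ZMod (n₁ * q₂))⁻¹).val : ℕ) : ℝ) /
                      ((n₁ : ℝ) * q₂)) : ℂ) *
                      (𝐞 (-((h : ℝ) * a₁ *
                    ((((((q₀ : ℤ) * l₁ * l₂ * n₁ : ℤ) : ZMod (a₂.natAbs * n₀))⁻¹).val : ℕ) : ℝ) /
                      ((a₂ : ℝ) * n₀))) : ℂ)))
            else 0) = 0 := by
  by_cases h1 : l₁ < a₂.natAbs * n₀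
  swap; · exact R1pp_eq_zero_of_fst_class_ge hm (not_lt.1 h1)
  by_cases h2 : l₂ < a₂.natAbs * n₀
  swap; · exact R1pp_eq_zero_of_snd_class_ge hm (not_lt.1 h2)
  by_cases h3 : Nat.Coprime l₁ a₂.natAbs
  swap; · exact R1pp_eq_zero_of_fst_class_a h3
  by_cases h4 : Nat.Coprime l₁ n₀
  swap; · exact R1pp_eq_zero_of_fst_class_n h4
  by_cases h5 : Nat.Coprime l₂ a₂.natAbs
  swap; · exact R1pp_eq_zero_of_snd_class_a h5
  by_cases h6 : Nat.Coprime l₂ n₀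
  swap; · exact R1pp_eq_zero_of_snd_class_n h6
  exact absurd ⟨h1, h2, Nat.Coprime.mul_right h3 h4, Nat.Coprime.mul_right h5 h6⟩ h

/-- **`H < W = q₀q₁q₂` on the support of `γ ⊗ γ`** as soon as `H < (S−Y)²/q₀` (`0 < Y ≤ S`).
[cite: Drappeau2017, §5.5 p. 20] -/
theorem H_lt_W_of_bump_ne_zero (hY : 0 < Y) (hSY : Y ≤ S) (hq₀ : 0 < q₀)
    (hH : (H : ℝ) < (S - Y) ^ 2 / q₀) (q₁ q₂ : ℕ)
    (h1 : BFI.bump S Y ((q₀ * q₁ : ℕ) : ℝ) ≠ 0) (h2 : BFI.bump S Y ((q₀ * q₂ : ℕ) : ℝ) ≠ 0) :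
    H < q₀ * q₁ * q₂ := by
  have hS : 0 ≤ S := by linarith
  have hq₀r : (0 : ℝ) < q₀ := by exact_mod_cast hq₀
  have hlt1 : S - Y < ((q₀ * q₁ : ℕ) : ℝ) := lt_of_not_ge fun h => h1 (BFI.bump_eq_zero_of_le hY hS h)
  have hlt2 : S - Y < ((q₀ * q₂ : ℕ) : ℝ) := lt_of_not_ge fun h => h2 (BFI.bump_eq_zero_of_le hY hS h)
  push_cast at hlt1 hlt2
  have hSY0 : 0 ≤ S - Y := by linarith
  have hprod : (S - Y) ^ 2 < ((q₀ : ℝ) * q₁) * ((q₀ : ℝ) * q₂) := by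
    rw [sq]; exact mul_lt_mul'' hlt1 hlt2 hSY0 hSY0
  rw [lt_div_iff₀ hq₀r] at hH
  have : (H : ℝ) < (q₀ * q₁ * q₂ : ℕ) := by push_cast; nlinarith
  exact_mod_cast this

/-- **`1 ∉ B`** when `2n₀ ≤ N`. [folklore] -/
theorem one_not_mem_Bset (hN : 0 ≤ N) (hn₀N : 2 * (n₀ : ℝ) ≤ N) : (1 : ℕ) ∉ ((((BFI.dyadic N).filter (fun n : ℕ => IsCoprime (n : ℤ) a₂)).filter (fun n : ℕ => n₀ ∣ n)).image (fun n : ℕ => n / n₀)) := by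
  intro h
  simp only [Finset.mem_image, Finset.mem_filter] at h
  obtain ⟨n, ⟨⟨hd, _⟩, hdvd⟩, hn⟩ := h
  have hlt : n < 2 * n₀ := by
    by_contra h'
    have : 2 ≤ n / n₀ := by
      rcases Nat.eq_zero_or_pos n₀ with h0 | hpos
      · subst h0; simp at hdvd; subst hdvd; simp at hn
      · exact (Nat.le_div_iff_mul_le hpos).2 (by omega)
    omega
  have hNn := ((BFI.mem_dyadic hN).1 hd).1
  have : (n : ℝ) < 2 * n₀ := by exact_mod_cast hlt
  linarith

/-- **Size of the rough variable**: for `n₁, n₂ ∈ B` and `|h| ≤ H`,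
`|a₁ h (n₁−n₂)/q₀| ≤ |a₁|·H·2N` — so `< 2^K` once `|a₁| H · 2N < 2^K`. [cite: Drappeau2017, §5.5] -/
theorem natAbs_rough_lt (hN : 0 ≤ N) {K : ℕ}
    (hK : (a₁.natAbs : ℝ) * H * (2 * N) < (2 : ℝ) ^ K) {n₁ n₂ : ℕ} (hn₁ : n₁ ∈ ((((BFI.dyadic N).filter (fun n : ℕ => IsCoprime (n : ℤ) a₂)).filter (fun n : ℕ => n₀ ∣ n)).image (fun n : ℕ => n / n₀)))
    (hn₂ : n₂ ∈ ((((BFI.dyadic N).filter (fun n : ℕ => IsCoprime (n : ℤ) a₂)).filter (fun n : ℕ => n₀ ∣ n)).image (fun n : ℕ => n / n₀))) {h : ℤ} (hh : h ∈ Finset.Icc (-(H : ℤ)) H) :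
    (a₁ * h * (((n₁ : ℤ) - n₂) / q₀)).natAbs < 2 ^ K := by
  -- sizes of `n₁, n₂`
  have hnj : ∀ n ∈ ((((BFI.dyadic N).filter (fun n : ℕ => IsCoprime (n : ℤ) a₂)).filter (fun n : ℕ => n₀ ∣ n)).image (fun n : ℕ => n / n₀)), (n : ℝ) ≤ 2 * N := by
    intro n hn
    simp only [Finset.mem_image, Finset.mem_filter] at hn
    obtain ⟨n', ⟨⟨hd, _⟩, hdvd⟩, rfl⟩ := hn
    have h2 := ((BFI.mem_dyadic hN).1 hd).2
    have hle : ((n' / n₀ : ℕ) : ℝ) ≤ n' := by exact_mod_cast Nat.div_le_self n' n₀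
    linarith
  have hb1 := hnj n₁ hn₁
  have hb2 := hnj n₂ hn₂
  rw [Finset.mem_Icc] at hh
  have hhabs : (h.natAbs : ℝ) ≤ H := by
    have : (h.natAbs : ℤ) ≤ H := by rw [Int.natCast_natAbs]; exact abs_le.2 ⟨hh.1, hh.2⟩
    exact_mod_cast this
  have hdiff : ((((n₁ : ℤ) - n₂) / q₀).natAbs : ℝ) ≤ 2 * N := by
    have h1 : (((n₁ : ℤ) - n₂) / q₀).natAbs ≤ ((n₁ : ℤ) - n₂).natAbs := Int.natAbs_ediv_le_natAbs _ _
    have h2 : (((n₁ : ℤ) - n₂).natAbs : ℝ) ≤ max (n₁ : ℝ) n₂ := by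
      rcases le_total n₂ n₁ with hle | hle
      · have e : ((n₁ : ℤ) - n₂).natAbs = n₁ - n₂ := by
          rw [show (n₁ : ℤ) - n₂ = ((n₁ - n₂ : ℕ) : ℤ) by push_cast [Nat.cast_sub hle]; ring,
            Int.natAbs_natCast]
        rw [e]; push_cast [Nat.cast_sub hle]
        linarith [le_max_left (n₁ : ℝ) n₂, (Nat.cast_nonneg n₂ : (0 : ℝ) ≤ n₂)]
      · have e : ((n₁ : ℤ) - n₂).natAbs = n₂ - n₁ := by
          rw [show (n₁ : ℤ) - n₂ = -((n₂ - n₁ : ℕ) : ℤ) by push_cast [Nat.cast_sub hle]; ring,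
            Int.natAbs_neg, Int.natAbs_natCast]
        rw [e]; push_cast [Nat.cast_sub hle]
        linarith [le_max_right (n₁ : ℝ) n₂, (Nat.cast_nonneg n₁ : (0 : ℝ) ≤ n₁)]
    have h3 : max (n₁ : ℝ) n₂ ≤ 2 * N := max_le hb1 hb2
    calc _ ≤ (((n₁ : ℤ) - n₂).natAbs : ℝ) := by exact_mod_cast h1
      _ ≤ _ := h2.trans h3
  have key : ((a₁ * h * (((n₁ : ℤ) - n₂) / q₀)).natAbs : ℝ) < (2 : ℝ) ^ K := by
    rw [Int.natAbs_mul, Int.natAbs_mul]; push_cast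
    calc (a₁.natAbs : ℝ) * h.natAbs * (((n₁ : ℤ) - n₂) / q₀).natAbs
        ≤ (a₁.natAbs : ℝ) * H * (2 * N) := by
          apply mul_le_mul (mul_le_mul_of_nonneg_left hhabs (by positivity)) hdiff (by positivity)
            (by positivity)
      _ < _ := hK
  exact_mod_cast key

end Edge

end Drappeau2017

end Literature.NumberTheory.Sieve

end
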